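import Mathlib
import Literature.AlgebraicGeometry.Resolution.AbhyankarInvariants
import HarnessLib

/-!
# A finite extension of a discretely valued field has cyclic value group
(`stub_isCyclic_valueGroup_of_finite`; crux `SemivaluationShadows`, line `birth`)

Registered sub-goal `stub_isCyclic_valueGroup_of_finite` of the crux
`stmt-ResolutionOfSingularities-16757` (`Theses.AbhyankarShadows.SemivaluationShadows`, the
EXISTENCE half of Teissier's semivaluation conjecture typed over finite sets), line `birth`.
In the proof of the crux for ruled function fields `K = K₀(y)` (`ν|K₀` discrete, of rational rank
one) the transcendental `y` is specialised to an algebraic `ρ'` and the shadow lives on the FINITE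
extension `L = K₀(ρ')` of `K₀`; this file shows that the value group of `L` is again cyclic, so
that `L` has a uniformiser (`exists_uniformizer_of_isCyclic`) and the resulting one-element frame
can be fed to `Theorems.frameShadow`.

**Statement** (`isCyclic_valueGroup_of_finite`; registered one-term form
`stub_isCyclic_valueGroup_of_finite`). Let `L / F₀` be a finite field extension, `O'` a valuation
ring of `L` with valuation `ν`, and `t ∈ F₀` non-zero in `L` such that the value of every non-zero
element of `F₀` is an integral power of `ν(t)` ("`ν|F₀` is discrete with uniformiser `t`", or
trivial). Then the value group `Γ_L = (O'.ValueGroup)ˣ` is cyclic.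

**Proof.** Let `g = ν(t) ∈ Γ_L` and `H = ⟨g⟩`. By hypothesis `H` contains the value of every
non-zero element of the image of `F₀`, i.e. of the bottom intermediate field `⊥ ≤ L`
(`IntermediateField.mem_bot`). By the value half of the FUNDAMENTAL INEQUALITY (tree
`Literature.AlgebraicGeometry.Resolution.finiteIndex_of_forall_mk0_valuation_mem`: non-zero
elements of `L` whose values lie in pairwise distinct cosets of `H` are `F₀`-linearly independent,
by the ultrametric inequality, so there are at most `[L : F₀]` cosets) `H` has finite index `n` in
`Γ_L`. Hence `u ↦ uⁿ` maps `Γ_L` into `H` (`Subgroup.pow_index_mem`), injectively because the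
linearly ordered commutative group `Γ_L` is torsion-free; so `Γ_L` embeds in the cyclic group `H`
and is itself cyclic (`isCyclic_of_injective`): `isCyclic_of_finiteIndex_zpowers`. The hypothesis
`ν(t) < 1` of the registered signature is not used (if `ν(t) = 1` the same argument shows that
`Γ_L` is trivial).

## Sources

* O. Zariski, P. Samuel, *Commutative Algebra* II, Ch. VI §11 (the inequality `e f ≤ n` for a
  finite extension; a finite extension of a discrete rank-one valuation is discrete). [folklore]
* M. Temkin, *Inseparable local uniformization*, J. Algebra 373 (2013), §2.1, p. 9 (the form
  `[Γ_L : Γ_F] ≤ [L : F]` rendered in the tree file `AbhyankarInvariants.lean`). [folklore]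

No named facts are used; the file declares no definition. [folklore]
-/

-- single-problem summit: the doubled namespace component `ResolutionOfSingularities` is forced
set_option linter.dupNamespace false

noncomputable section

open Literature.AlgebraicGeometry.Resolution

namespace Summit.ResolutionOfSingularities.ResolutionOfSingularities.Theorems

universe u

/-- **A torsion-free commutative group with a cyclic subgroup of finite index is cyclic.** If
`⟨g⟩ ≤ G` has finite index `n`, then `u ↦ uⁿ` is an injective homomorphism of `G` into the
cyclic group `⟨g⟩` (`uⁿ ∈ ⟨g⟩` by `Subgroup.pow_index_mem`; injective by torsion-freeness), and a
group embedding into a cyclic group is cyclic. [folklore] -/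
theorem isCyclic_of_finiteIndex_zpowers {G : Type*} [CommGroup G] [IsMulTorsionFree G] (g : G)
    [(Subgroup.zpowers g).FiniteIndex] : IsCyclic G := by
  have hn : (Subgroup.zpowers g).index ≠ 0 := Subgroup.FiniteIndex.index_ne_zero
  refine isCyclic_of_injective
    ((powMonoidHom (Subgroup.zpowers g).index).codRestrict (Subgroup.zpowers g) fun u =>
      (Subgroup.zpowers g).pow_index_mem u) ?_
  rw [MonoidHom.injective_codRestrict]
  exact pow_left_injective hn

/-- **A finite extension of a discretely (or trivially) valued field has cyclic value group.**
Let `L / F₀` be a finite extension of fields, `O'` a valuation ring of `L` with valuation `ν`, and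
`t ∈ F₀` with `t ≠ 0` in `L` such that `ν(x) ∈ ν(t)^ℤ` for every non-zero `x ∈ F₀`. Then the
value group `(O'.ValueGroup)ˣ` of `L` is cyclic: the cyclic subgroup `⟨ν(t)⟩` contains the values
of `F₀^× = (⊥ : IntermediateField F₀ L)^×`, hence has index `≤ [L : F₀]` by the value half of
the fundamental inequality (`finiteIndex_of_forall_mk0_valuation_mem`), and a torsion-free group
with a cyclic subgroup of finite index is cyclic (`isCyclic_of_finiteIndex_zpowers`).
(Zariski–Samuel II, Ch. VI §11.) [folklore] -/
theorem isCyclic_valueGroup_of_finite {F₀ L : Type u} [Field F₀] [Field L] [Algebra F₀ L]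
    [FiniteDimensional F₀ L] (O' : ValuationSubring L) (t : F₀) (ht0 : algebraMap F₀ L t ≠ 0)
    (hdisc : ∀ x : F₀, x ≠ 0 →
      ∃ m : ℤ, O'.valuation (algebraMap F₀ L x) = O'.valuation (algebraMap F₀ L t) ^ m) :
    IsCyclic (O'.ValueGroup)ˣ := by
  -- the value `g = ν(t)` as a unit of the value group
  obtain ⟨g, hg⟩ : ∃ g : (O'.ValueGroup)ˣ, (g : O'.ValueGroup) = O'.valuation (algebraMap F₀ L t) :=
    ⟨Units.mk0 _ (valuation_ne_zero_of_ne_zero O' ht0), rfl⟩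
  -- `⟨g⟩` contains the value of every non-zero element of `F₀ = ⊥`
  have hmem : ∀ c : L, c ∈ (⊥ : IntermediateField F₀ L) → (hc : c ≠ 0) →
      Units.mk0 (O'.valuation c) (valuation_ne_zero_of_ne_zero O' hc) ∈ Subgroup.zpowers g := by
    intro c hc hc0
    obtain ⟨x, rfl⟩ := IntermediateField.mem_bot.mp hc
    have hx0 : x ≠ 0 := by
      rintro rfl
      exact hc0 (map_zero _)
    obtain ⟨m, hm⟩ := hdisc x hx0
    refine Subgroup.mem_zpowers_iff.mpr ⟨m, Units.ext ?_⟩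
    rw [Units.val_zpow_eq_zpow_val, hg, Units.val_mk0, hm]
  -- fundamental inequality: `⟨g⟩` has finite index (`≤ [L : F₀]`)
  obtain ⟨hfi, -⟩ :=
    finiteIndex_of_forall_mk0_valuation_mem O' (⊥ : IntermediateField F₀ L) (Subgroup.zpowers g)
      hmem
  exact isCyclic_of_finiteIndex_zpowers g

/-- **Registered sub-goal `stub_isCyclic_valueGroup_of_finite` of line `birth` for the crux
`SemivaluationShadows`** (the registered signature verbatim, fully quantified; it is
`isCyclic_valueGroup_of_finite`, the hypothesis `ν(t) < 1` being superfluous). [folklore] -/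
theorem stub_isCyclic_valueGroup_of_finite : ∀ (F₀ L : Type) [Field F₀] [Field L] [Algebra F₀ L] [FiniteDimensional F₀ L] (O' : ValuationSubring L) (t : F₀), algebraMap F₀ L t ≠ 0 → O'.valuation (algebraMap F₀ L t) < 1 → (∀ x : F₀, x ≠ 0 → ∃ m : ℤ, O'.valuation (algebraMap F₀ L x) = O'.valuation (algebraMap F₀ L t) ^ m) → IsCyclic (O'.ValueGroup)ˣ := by
  intro F₀ L _ _ _ _ O' t ht0 _ hdisc
  exact isCyclic_valueGroup_of_finite O' t ht0 hdisc

end Summit.ResolutionOfSingularities.ResolutionOfSingularities.Theorems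

end
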